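import Summits.CriticalPhenomena.PercolationContinuityZ3.Theorems.Transplant.SkelPhiCorridorKGMono
import Summits.CriticalPhenomena.PercolationContinuityZ3.Theorems.Transplant.SkelPhiCorridorKGYMono
import HarnessLib

/-!
# N2 (frames-only node `SamePDropOfSkeletonFrm₁`, OPEN), (C)/(R) column machinery: ARGUMENTWISE MONOTONICITY OF THE K-G FRAME-BOX HALF-EXTENTS —
# `Skelφ.kgZ₀_le`, `kgZ₁_le`, `kgZY₀_le`, `kgZY₁_le` (+ `kgA₁Y_mono`)

Complement to p3-g17's `SkelPhiCorridorKGMono`/`KGYMono` (monotonicity in the run length `N` at the schedule's own `m₁ m₂`): the frame-box half-extents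
`kgZ₀ n v R' ρ q N m₁ m₂`, `kgZ₁ n ℓ hs R' ρ W N m₁ Wm₂ Wp₂ m₂`, `kgZY₀ n v R' ρ W N m₁ Wm₂ Wp₂ m₂`, `kgZY₁ n ℓ hs R' ρ q N m₁ m₂` (SkelPhiCorridorKGBoxes) are
monotone in EACH of their count/window arguments as plain functions (nonnegative coefficients), so a corridor run at other slot values (the root's own `N_R, q, W`,
a prefix `Nx`) is bounded by the values of record argument by argument (p3-g17 2026-08-23T12:12:17Z: "useful for (R-46)").  Cell-free, hypothesis-free.
builds on p205010 (kernel theorem, internal audit signed; external expert review pending) — nothing in this file uses p205010; nothing here is a claim about the open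
node `SamePDropOfSkeletonFrm₁`.
Lane `prim-bschramm`, seat `prim-bschramm-p5` (gen 16; (C) column machinery); helper file (`--supports stmt-CriticalPhenomena-4575 --as helper`).
[cite: KozmaNitzan2024, §4 Lemma 11 (pp. 22–23), Lemma 12 (pp. 23–25)]
-/

namespace Summit.CriticalPhenomena.PercolationContinuityZ3.Theorems.Transplant

namespace Skelφ

open ChainPlanar ChainPara

/-- `Z₀` is monotone in each of `N, m₁, m₂`. [folklore] -/
theorem kgZ₀_le (n : ℕ) (v : ℤ) (R' ρ q : ℕ) {N N' m₁ m₁' m₂ m₂' : ℕ} (hN : N ≤ N') (h₁ : m₁ ≤ m₁') (h₂ : m₂ ≤ m₂') :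
    kgZ₀ n v R' ρ q N m₁ m₂ ≤ kgZ₀ n v R' ρ q N' m₁' m₂' := by
  unfold kgZ₀
  have hN' : (N : ℤ) ≤ N' := by exact_mod_cast hN
  have h₁' : (m₁ : ℤ) ≤ m₁' := by exact_mod_cast h₁
  have h₂' : (m₂ : ℤ) ≤ m₂' := by exact_mod_cast h₂
  have hR : (0 : ℤ) ≤ R' := by positivity
  have hc : (0 : ℤ) ≤ R' + ρ + |v| := by positivity
  have hc' : (0 : ℤ) ≤ R' + ρ := by positivity
  nlinarith

/-- `Z₁` is monotone in each of `N, m₁, Wm₂, Wp₂, m₂`. [folklore] -/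
theorem kgZ₁_le (n ℓ : ℕ) (hs : ℤ) (R' ρ W : ℕ) {N N' m₁ m₁' Wm₂ Wm₂' Wp₂ Wp₂' m₂ m₂' : ℕ} (hN : N ≤ N') (h₁ : m₁ ≤ m₁') (hm : Wm₂ ≤ Wm₂')
    (hp : Wp₂ ≤ Wp₂') (h₂ : m₂ ≤ m₂') : kgZ₁ n ℓ hs R' ρ W N m₁ Wm₂ Wp₂ m₂ ≤ kgZ₁ n ℓ hs R' ρ W N' m₁' Wm₂' Wp₂' m₂' := by
  unfold kgZ₁
  have hA : ((kgA₁ n ℓ hs R' W N : ℕ) : ℤ) ≤ kgA₁ n ℓ hs R' W N' := by exact_mod_cast kgA₁_mono n ℓ hs R' W hN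
  have h₁' : (m₁ : ℤ) ≤ m₁' := by exact_mod_cast h₁
  have h₂' : (m₂ : ℤ) ≤ m₂' := by exact_mod_cast h₂
  have hm' : (Wm₂ : ℤ) ≤ Wm₂' := by exact_mod_cast hm
  have hp' : (Wp₂ : ℤ) ≤ Wp₂' := by exact_mod_cast hp
  have hc' : (0 : ℤ) ≤ R' + ρ := by positivity
  nlinarith

/-- `A⁺ = (n−v)⁺ + W + (N+1)R′` and `A⁻ = (n+v)⁺ + W + (N+1)R′` are nondecreasing in `N`. [folklore] -/
theorem kgA₁Y_mono (n : ℕ) (v : ℤ) (R' W : ℕ) {N N' : ℕ} (h : N ≤ N') :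
    kgA₁Yp n v R' W N ≤ kgA₁Yp n v R' W N' ∧ kgA₁Ym n v R' W N ≤ kgA₁Ym n v R' W N' := by
  unfold kgA₁Yp kgA₁Ym
  have := Nat.mul_le_mul_right R' (Nat.add_le_add_right h 1)
  omega

/-- `ZY₀` is monotone in each of `W, N, m₁, Wm₂, Wp₂, m₂`. [folklore] -/
theorem kgZY₀_le (n : ℕ) (v : ℤ) (R' ρ : ℕ) {W W' N N' m₁ m₁' Wm₂ Wm₂' Wp₂ Wp₂' m₂ m₂' : ℕ} (hW : W ≤ W') (hN : N ≤ N') (h₁ : m₁ ≤ m₁')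
    (hm : Wm₂ ≤ Wm₂') (hp : Wp₂ ≤ Wp₂') (h₂ : m₂ ≤ m₂') :
    kgZY₀ n v R' ρ W N m₁ Wm₂ Wp₂ m₂ ≤ kgZY₀ n v R' ρ W' N' m₁' Wm₂' Wp₂' m₂' := by
  unfold kgZY₀
  have hW' : (W : ℤ) ≤ W' := by exact_mod_cast hW
  have hN' : (N : ℤ) ≤ N' := by exact_mod_cast hN
  have h₁' : (m₁ : ℤ) ≤ m₁' := by exact_mod_cast h₁
  have h₂' : (m₂ : ℤ) ≤ m₂' := by exact_mod_cast h₂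
  have hm' : (Wm₂ : ℤ) ≤ Wm₂' := by exact_mod_cast hm
  have hp' : (Wp₂ : ℤ) ≤ Wp₂' := by exact_mod_cast hp
  have hR : (0 : ℤ) ≤ R' := by positivity
  have hva : (0 : ℤ) ≤ |v| := abs_nonneg _
  have hc : (0 : ℤ) ≤ R' + ρ + |v| := by positivity
  nlinarith

/-- `ZY₁` is monotone in each of `q, N, m₁, m₂`. [folklore] -/
theorem kgZY₁_le (n ℓ : ℕ) (hs : ℤ) (R' ρ : ℕ) {q q' N N' m₁ m₁' m₂ m₂' : ℕ} (hq : q ≤ q') (hN : N ≤ N') (h₁ : m₁ ≤ m₁') (h₂ : m₂ ≤ m₂') :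
    kgZY₁ n ℓ hs R' ρ q N m₁ m₂ ≤ kgZY₁ n ℓ hs R' ρ q' N' m₁' m₂' := by
  unfold kgZY₁
  have hq' : (q : ℤ) ≤ q' := by exact_mod_cast hq
  have hN' : (N : ℤ) ≤ N' := by exact_mod_cast hN
  have h₁' : (m₁ : ℤ) ≤ m₁' := by exact_mod_cast h₁
  have h₂' : (m₂ : ℤ) ≤ m₂' := by exact_mod_cast h₂
  have hR : (0 : ℤ) ≤ R' := by positivity
  have hd : (0 : ℤ) ≤ (dS n ℓ hs : ℕ) := by positivity
  have hc : (0 : ℤ) ≤ R' + ρ := by positivity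
  nlinarith

end Skelφ

end Summit.CriticalPhenomena.PercolationContinuityZ3.Theorems.Transplant
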